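import Mathlib.Algebra.Polynomial.Laurent
import Mathlib.RingTheory.GradedAlgebra.HomogeneousLocalization
import Mathlib.RingTheory.GradedAlgebra.Basic

/-!
# The cone chart: `A[1/x] ≅ A₍ₓ₎[T, T⁻¹]` for a homogeneous element `x` of degree one

Support file for crux stmt-ResolutionOfSingularities-15315 (`FrobeniusLadder.FInjectiveMacaulayfication`,
line `Sketch`, lead seat c5, cycle 6, wave 2): stub `stub_coneChartLaurent`.

For a blow-up `Bl_I(Spec R) = Proj R[It]` the exceptional divisor is `E = Proj gr_I(R)`, and the chart
`D(x̄) = Spec gr_I(R)[1/x̄]` of the affine cone `Spec gr_I(R)` sits over the chart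
`D₊(x̄) = Spec gr_I(R)_{(x̄)}` of `E`.  This file records the precise relation between the two chart
rings for an arbitrary `ℕ`-graded algebra `A = ⨁ₙ 𝒜 n` and `x ∈ 𝒜 1`:
the localization `A[1/x] = Localization.Away x` is the ring of Laurent polynomials in the variable
`x` over the degree-zero part `A₍ₓ₎ = HomogeneousLocalization.Away 𝒜 x` (Stacks Tag 00JO-style
bookkeeping; EGA II (2.2.1)).

## Proof

We write down both ring homomorphisms and check that they are mutually inverse on generators.
To keep the file free of auxiliary definitions, the two maps enter the helper lemmas as variables
constrained by their values on generators.

* `φ : A₍ₓ₎[T;T⁻¹] →+* A[1/x]` is any ring map with `φ (C c) = c` and `φ T = x / 1` (in the end: the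
  Laurent evaluation map `LaurentPolynomial.eval₂` at the unit `x / 1`, coefficients embedded by
  `HomogeneousLocalization.val`).
* `ψ₀ : A →+* A₍ₓ₎[T;T⁻¹]` is any ring map with `ψ₀ a = C (a / xⁱ) · Tⁱ` for `a ∈ 𝒜 i`; such a map
  exists (`exists_psi0`): assemble the additive maps `𝒜 i →+ A₍ₓ₎[T;T⁻¹]`, `a ↦ C (a / xⁱ) · Tⁱ`, which
  are multiplicative across degrees, with `DirectSum.toSemiring`, and precompose with the
  decomposition `A ≃+* ⨁ᵢ 𝒜 i`.  Since `ψ₀ x = T` is a unit, `ψ₀` extends to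
  `ψ : A[1/x] →+* A₍ₓ₎[T;T⁻¹]` (`IsLocalization.Away.lift`), entering the lemmas through
  `ψ (a / 1) = ψ₀ a`.
* `φ ∘ ψ = id` (`phi_comp_psi`): ring maps out of a localization agree once they agree on `A`
  (`IsLocalization.ringHom_ext`), where it suffices to compare them on homogeneous elements
  (`DirectSum.Decomposition.inductionOn`): `φ (C (a / xⁱ) · Tⁱ) = (a / xⁱ) · xⁱ = a`.
* `ψ ∘ φ = id` (`psi_comp_phi`): ring maps out of the group algebra `A₍ₓ₎[ℤ]` agree once they agree
  on constants and on the monomials `Tⁿ` (`AddMonoidAlgebra.ringHom_ext'`); on monomials it suffices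
  to check `T¹` (`MonoidHom.ext_mint`): `ψ (φ T) = ψ (x / 1) = ψ₀ x = T`; on a constant `c = a / xⁿ`
  (`a ∈ 𝒜 n`, `HomogeneousLocalization.Away.mk_surjective`):
  `ψ (φ (C c)) = ψ (a / xⁿ) = ψ₀ a · T⁻ⁿ = C c · Tⁿ · T⁻ⁿ = C c`.

If `x` is nilpotent all rings involved are trivial and everything holds vacuously; the argument does
not distinguish this case.  Everything here is folklore; no definition is declared.
-/

-- single-problem summit: the doubled namespace component `ResolutionOfSingularities` is forced
set_option linter.dupNamespace false

noncomputable section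

namespace Summit.ResolutionOfSingularities.ResolutionOfSingularities.Theorems.FInjectiveMacaulayfication.ConeChartLaurent

open scoped LaurentPolynomial
open HomogeneousLocalization

variable {R A : Type} [CommRing R] [CommRing A] [Algebra R A]
  (𝒜 : ℕ → Submodule R A) [GradedAlgebra 𝒜] {x : A}

/-! ### Degree-zero fractions `a / xⁱ` (`HomogeneousLocalization.Away.mk`) -/

omit [GradedAlgebra 𝒜] in
/-- Index bookkeeping: `𝒜 i = 𝒜 (i • 1)` (the degree convention of `HomogeneousLocalization.Away.mk`
for `x` of degree `1`). [folklore] -/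
theorem mem_smul_one {i : ℕ} {a : A} (ha : a ∈ 𝒜 i) : a ∈ 𝒜 (i • 1) := by
  simpa using ha

/-- `0 / xⁱ = 0` in `A₍ₓ₎`. [folklore] -/
theorem awayMk_eq_zero (hx : x ∈ 𝒜 1) (i : ℕ) (a : A) (ha : a ∈ 𝒜 (i • 1)) (h : a = 0) :
    Away.mk 𝒜 hx i a ha = 0 := by
  apply val_injective
  rw [Away.val_mk, val_zero, h, Localization.mk_zero]

/-- `(a + b) / xⁱ = a / xⁱ + b / xⁱ` in `A₍ₓ₎`. [folklore] -/
theorem awayMk_add (hx : x ∈ 𝒜 1) (i : ℕ) (a b : A) (ha : a ∈ 𝒜 (i • 1)) (hb : b ∈ 𝒜 (i • 1))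
    (hab : a + b ∈ 𝒜 (i • 1)) :
    Away.mk 𝒜 hx i (a + b) hab = Away.mk 𝒜 hx i a ha + Away.mk 𝒜 hx i b hb := by
  apply val_injective
  rw [val_add, Away.val_mk, Away.val_mk, Away.val_mk, Localization.add_mk_self]

/-- `(a * b) / x ^ (i + j) = (a / xⁱ) * (b / xʲ)` in `A₍ₓ₎`. [folklore] -/
theorem awayMk_mul (hx : x ∈ 𝒜 1) (i j : ℕ) (a b : A) (ha : a ∈ 𝒜 (i • 1)) (hb : b ∈ 𝒜 (j • 1))
    (hab : a * b ∈ 𝒜 ((i + j) • 1)) :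
    Away.mk 𝒜 hx (i + j) (a * b) hab = Away.mk 𝒜 hx i a ha * Away.mk 𝒜 hx j b hb := by
  apply val_injective
  rw [val_mul, Away.val_mk, Away.val_mk, Away.val_mk, Localization.mk_mul]
  congr 1
  exact Subtype.ext (pow_add x i j)

/-- `1 / x ^ 0 = 1` in `A₍ₓ₎`. [folklore] -/
theorem awayMk_one (hx : x ∈ 𝒜 1) (h1 : (1 : A) ∈ 𝒜 (0 • 1)) : Away.mk 𝒜 hx 0 1 h1 = 1 := by
  apply val_injective
  rw [Away.val_mk, val_one, ← Localization.mk_one]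
  congr 1
  exact Subtype.ext (pow_zero x)

/-- `x / x ^ 1 = 1` in `A₍ₓ₎`. [folklore] -/
theorem awayMk_self (hx : x ∈ 𝒜 1) (h1 : x ∈ 𝒜 (1 • 1)) : Away.mk 𝒜 hx 1 x h1 = 1 := by
  apply val_injective
  rw [Away.val_mk, val_one, ← Localization.mk_self (⟨x ^ 1, 1, rfl⟩ : Submonoid.powers x)]
  congr 1
  exact (pow_one x).symm

/-! ### The ring map `ψ₀ : A → A₍ₓ₎[T;T⁻¹]`, `a ↦ Σᵢ C (aᵢ / xⁱ) · Tⁱ` -/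

/-- There is a ring homomorphism `ψ₀ : A →+* A₍ₓ₎[T;T⁻¹]` with `ψ₀ a = C (a / xⁱ) * Tⁱ` for every
homogeneous `a ∈ 𝒜 i`: the degreewise additive maps `a ↦ C (a / xⁱ) * Tⁱ` are multiplicative across
degrees, so they assemble to a ring map on `⨁ᵢ 𝒜 i ≅ A` (`DirectSum.toSemiring`,
`DirectSum.decomposeRingEquiv`). [folklore] -/
theorem exists_psi0 (hx : x ∈ 𝒜 1) :
    ∃ ψ₀ : A →+* (Away 𝒜 x)[T;T⁻¹], ∀ (i : ℕ) (a : A) (ha : a ∈ 𝒜 (i • 1)),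
      ψ₀ a = LaurentPolynomial.C (Away.mk 𝒜 hx i a ha) * LaurentPolynomial.T (i : ℤ) := by
  -- the degree-`i` piece, as an additive map
  let piece : ∀ i : ℕ, 𝒜 i →+ (Away 𝒜 x)[T;T⁻¹] := fun i =>
    { toFun := fun a =>
        LaurentPolynomial.C (Away.mk 𝒜 hx i a (mem_smul_one 𝒜 a.2)) * LaurentPolynomial.T (i : ℤ)
      map_zero' := by
        rw [awayMk_eq_zero 𝒜 hx i _ _ (Submodule.coe_zero (p := 𝒜 i)), map_zero, zero_mul]
      map_add' := fun a b => by
        rw [← add_mul, ← map_add, ← awayMk_add 𝒜 hx i a b]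
        rfl }
  have piece_apply : ∀ (i : ℕ) (a : 𝒜 i), piece i a =
      LaurentPolynomial.C (Away.mk 𝒜 hx i a (mem_smul_one 𝒜 a.2)) * LaurentPolynomial.T (i : ℤ) :=
    fun _ _ => rfl
  -- the pieces are multiplicative across degrees
  have hone : piece 0 (GradedMonoid.GOne.one (A := fun i => ↥(𝒜 i))) = 1 := by
    rw [piece_apply]
    simp only [SetLike.coe_gOne, Nat.cast_zero, LaurentPolynomial.T_zero, mul_one]
    rw [awayMk_one 𝒜 hx, map_one]
  have hmul : ∀ {i j : ℕ} (a : 𝒜 i) (b : 𝒜 j),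
      piece (i + j) (GradedMonoid.GMul.mul (A := fun i => ↥(𝒜 i)) a b) = piece i a * piece j b := by
    intro i j a b
    rw [piece_apply, piece_apply, piece_apply]
    simp only [SetLike.coe_gMul]
    rw [awayMk_mul 𝒜 hx i j a b (mem_smul_one 𝒜 a.2) (mem_smul_one 𝒜 b.2), map_mul, Nat.cast_add,
      LaurentPolynomial.T_add]
    ring
  refine ⟨(DirectSum.toSemiring piece hone hmul).comp (DirectSum.decomposeRingEquiv 𝒜).toRingHom,
    fun i a ha => ?_⟩
  have ha' : a ∈ 𝒜 i := by simpa using ha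
  show DirectSum.toSemiring piece hone hmul (DirectSum.decompose 𝒜 a) = _
  rw [DirectSum.decompose_of_mem 𝒜 ha', DirectSum.toSemiring_of, piece_apply]

section maps

variable (hx : x ∈ 𝒜 1)
  {ψ₀ : A →+* (Away 𝒜 x)[T;T⁻¹]}
  (hψ₀ : ∀ (i : ℕ) (a : A) (ha : a ∈ 𝒜 (i • 1)),
    ψ₀ a = LaurentPolynomial.C (Away.mk 𝒜 hx i a ha) * LaurentPolynomial.T (i : ℤ))
  {ψ : Localization.Away x →+* (Away 𝒜 x)[T;T⁻¹]}
  (hψ : ∀ a : A, ψ (algebraMap A (Localization.Away x) a) = ψ₀ a)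
  {φ : (Away 𝒜 x)[T;T⁻¹] →+* Localization.Away x}
  (hC : ∀ c : Away 𝒜 x, φ (LaurentPolynomial.C c) = c.val)
  (hT : φ (LaurentPolynomial.T 1) = algebraMap A (Localization.Away x) x)

include hψ₀ in
/-- `ψ₀ x = T`. [folklore] -/
theorem psi0_self : ψ₀ x = LaurentPolynomial.T 1 := by
  rw [hψ₀ 1 x (mem_smul_one 𝒜 hx), awayMk_self, map_one, one_mul, Nat.cast_one]

include hψ₀ in
/-- `ψ₀ x` is a unit (it is `T`), so `ψ₀` extends to the localization `A[1/x]`. [folklore] -/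
theorem isUnit_psi0_self : IsUnit (ψ₀ x) := by
  rw [psi0_self 𝒜 hx hψ₀]
  exact LaurentPolynomial.isUnit_T 1

include hψ₀ hψ in
/-- `ψ (a / xⁿ) = ψ₀ a * T⁻ⁿ` for the extension `ψ` of `ψ₀` to `A[1/x]`. [folklore] -/
theorem psi_mk (a : A) (n : ℕ) :
    ψ (Localization.mk a ⟨x ^ n, n, rfl⟩) = ψ₀ a * LaurentPolynomial.T (-(n : ℤ)) := by
  have h : Localization.mk a (⟨x ^ n, n, rfl⟩ : Submonoid.powers x) *
      algebraMap A (Localization.Away x) x ^ n = algebraMap A (Localization.Away x) a := by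
    rw [← map_pow, Localization.mk_eq_mk']
    exact IsLocalization.mk'_spec (Localization.Away x) a (⟨x ^ n, n, rfl⟩ : Submonoid.powers x)
  have h2 := congr_arg ψ h
  rw [map_mul, map_pow, hψ, hψ, psi0_self 𝒜 hx hψ₀, LaurentPolynomial.T_pow, mul_one] at h2
  rw [← h2, mul_assoc, ← LaurentPolynomial.T_add, add_neg_cancel, LaurentPolynomial.T_zero, mul_one]

include hT in
/-- `φ (Tⁿ) = (x / 1) ^ n`. [folklore] -/
theorem phi_T_nat (n : ℕ) :
    φ (LaurentPolynomial.T (n : ℤ)) = algebraMap A (Localization.Away x) x ^ n := by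
  rw [← hT, ← map_pow, LaurentPolynomial.T_pow, mul_one]

include hC hT in
/-- `φ (C (a / xⁱ) * Tⁱ) = a / 1` for `a ∈ 𝒜 i`. [folklore] -/
theorem phi_C_mul_T (i : ℕ) (a : A) (ha : a ∈ 𝒜 (i • 1)) :
    φ (LaurentPolynomial.C (Away.mk 𝒜 hx i a ha) * LaurentPolynomial.T (i : ℤ)) =
      algebraMap A (Localization.Away x) a := by
  have h := IsLocalization.mk'_spec (Localization.Away x) a (⟨x ^ i, i, rfl⟩ : Submonoid.powers x)
  rw [map_mul, hC, phi_T_nat 𝒜 hT, Away.val_mk, ← map_pow, Localization.mk_eq_mk']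
  exact h

include hψ₀ hC hT in
/-- `φ (ψ₀ a) = a / 1` for every `a : A` (check on homogeneous elements). [folklore] -/
theorem phi_psi0 (a : A) : φ (ψ₀ a) = algebraMap A (Localization.Away x) a := by
  induction a using DirectSum.Decomposition.inductionOn 𝒜 with
  | zero => rw [map_zero, map_zero, map_zero]
  | homogeneous m =>
    rw [hψ₀ _ m (mem_smul_one 𝒜 m.2)]
    exact phi_C_mul_T 𝒜 hx hC hT _ m _
  | add m m' hm hm' => rw [map_add, map_add, map_add, hm, hm']

include hψ₀ hψ hC hT in
/-- `φ ∘ ψ = id` on `A[1/x]` (ring maps out of a localization are determined on `A`). [folklore] -/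
theorem phi_comp_psi : φ.comp ψ = RingHom.id (Localization.Away x) := by
  apply IsLocalization.ringHom_ext (Submonoid.powers x)
  ext a
  simp only [RingHom.comp_apply, RingHom.id_apply]
  rw [hψ, phi_psi0 𝒜 hx hψ₀ hC hT]

include hψ₀ hψ hC hT in
/-- `ψ ∘ φ = id` on `A₍ₓ₎[T;T⁻¹]` (ring maps out of the group algebra `A₍ₓ₎[ℤ]` are determined on
constants and on `T`). [folklore] -/
theorem psi_comp_phi : ψ.comp φ = RingHom.id ((Away 𝒜 x)[T;T⁻¹]) := by
  apply AddMonoidAlgebra.ringHom_ext'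
  · -- on constants `C c`, `c = a / xⁿ` with `a ∈ 𝒜 n`
    refine RingHom.ext fun c => ?_
    obtain ⟨n, a, ha, rfl⟩ := Away.mk_surjective 𝒜 hx c
    show ψ (φ (LaurentPolynomial.C (Away.mk 𝒜 hx n a ha))) = LaurentPolynomial.C (Away.mk 𝒜 hx n a ha)
    rw [hC, Away.val_mk, psi_mk 𝒜 hx hψ₀ hψ, hψ₀ n a ha, mul_assoc, ← LaurentPolynomial.T_add,
      add_neg_cancel, LaurentPolynomial.T_zero, mul_one]
  · -- on the monomials `Tⁿ` it suffices to treat `T`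
    apply MonoidHom.ext_mint
    show ψ (φ (LaurentPolynomial.T 1)) = LaurentPolynomial.T 1
    rw [hT, hψ, psi0_self 𝒜 hx hψ₀]

end maps

/-! ### The registered statement -/

/-- **Cone chart** (`A_x ≅ A_{(x)}[T, T⁻¹]` for `x` of degree one).  For an `ℕ`-graded algebra
`A = ⨁ₙ 𝒜 n` over `R` and `x ∈ 𝒜 1` there is a ring isomorphism
`e : A₍ₓ₎[T;T⁻¹] ≃+* A[1/x]` from the Laurent polynomial ring over the degree-zero localization
`A₍ₓ₎ = HomogeneousLocalization.Away 𝒜 x` onto `Localization.Away x`, normalised by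
`e (C c) = c` (the inclusion `A₍ₓ₎ ⊆ A[1/x]`) and `e T = x / 1`.  Proof: `e` is Laurent evaluation at
the unit `x / 1`; its inverse is the extension to `A[1/x]` of `a ↦ Σᵢ C (aᵢ / xⁱ) · Tⁱ`
(`exists_psi0`); the two composites are the identity by `phi_comp_psi`, `psi_comp_phi`.
[folklore] [cite: StacksProject, Tag 00JO] -/
theorem stub_coneChartLaurent : ∀ (R A : Type) [CommRing R] [CommRing A] [Algebra R A]
    (𝒜 : ℕ → Submodule R A) [GradedAlgebra 𝒜] (x : A), x ∈ 𝒜 1 →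
    ∃ e : LaurentPolynomial (HomogeneousLocalization.Away 𝒜 x) ≃+* Localization.Away x,
      (∀ c : HomogeneousLocalization.Away 𝒜 x, e (LaurentPolynomial.C c) = c.val) ∧
      e (LaurentPolynomial.T 1) = algebraMap A (Localization.Away x) x := by
  intro R A _ _ _ 𝒜 _ x hx
  obtain ⟨ψ₀, hψ₀⟩ := exists_psi0 𝒜 hx
  -- `φ`: Laurent evaluation at the unit `x / 1`
  have hu := IsLocalization.Away.algebraMap_isUnit (S := Localization.Away x) x
  have hC : ∀ c : Away 𝒜 x,
      LaurentPolynomial.eval₂ (algebraMap (Away 𝒜 x) (Localization.Away x)) hu.unit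
        (LaurentPolynomial.C c) = c.val := fun c => by
    simp
  have hT : LaurentPolynomial.eval₂ (algebraMap (Away 𝒜 x) (Localization.Away x)) hu.unit
      (LaurentPolynomial.T 1) = algebraMap A (Localization.Away x) x := by
    simp
  -- `ψ`: the extension of `ψ₀` to `A[1/x]`
  have hψ : ∀ a : A, IsLocalization.Away.lift x (isUnit_psi0_self 𝒜 hx hψ₀)
      (algebraMap A (Localization.Away x) a) = ψ₀ a :=
    fun a => IsLocalization.Away.lift_eq x (isUnit_psi0_self 𝒜 hx hψ₀) a
  exact ⟨RingEquiv.ofRingHom _ _ (phi_comp_psi 𝒜 hx hψ₀ hψ hC hT) (psi_comp_phi 𝒜 hx hψ₀ hψ hC hT),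
    hC, hT⟩

end Summit.ResolutionOfSingularities.ResolutionOfSingularities.Theorems.FInjectiveMacaulayfication.ConeChartLaurent

end
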